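import Summits.QuantumFields.YangMills.Theses.ConvexGribovBody
import Summits.QuantumFields.YangMills.Theses.CertificationLength
import Summits.QuantumFields.YangMills.Theses.OneCertifiedCube
import Summits.QuantumFields.YangMills.Theorems.OneCertifiedCubeFiniteSizeCriterion
import HarnessLib

/-!
# `NonSimplyConnectedLatticeGap` — funnel entry from a Dobrushin–Shlosman finite-size condition at large `β`
# (crux stmt-QuantumFields-16405, route `ConvexGribovBody`, line `Sketch` = card `sectors-are-boundary-conditions`)

The crux `ConvexGribovBody.NonSimplyConnectedLatticeGap` is the volume-uniform weak-coupling lattice mass gap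
(time clustering of all pairs of gauge-invariant local observables on the tori `(2S+1)⁴`, `S ≥ S₁(β)`, `n ≤ S`)
for compact simple `G` with `π₁(G) ≠ 0` (`SO(3)`, `PSU(N)`, …) and faithful unitary `r`, at every `β ≥ β₀(G, r)`.
This file lands the line's TRANSFER and its attachment to an existing item:

* `nonSimplyConnectedLatticeGap_of_cellAnalyticityNSC` / registered form `stub_cruxOfCellAnalyticityNSC` —
  **C⁺ ⇒ crux**: if for every such `(G, r)` there is `β₂` such that at every `β ≥ β₂` the Wilson specification
  `ymSpecification r.ρ β` satisfies the total-variation finite-size condition of `OneCertifiedCube.FiniteSizeCriterion`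
  at SOME admissible window/threshold `(n, ε)` (`n ≥ 1`, `ε·M(n) < 1`, `M(n) = (4n+3)⁴ − (4n+1)⁴`) and SOME cell
  size `b ≥ 1`, then the crux holds, with `m(β) = κ(n,ε)/b`, `S₁(β) = (8n+7) b` and `C = C(A, B, n, ε)`. The engine is
  the tree's PROVED criterion `FiniteSizeCriterion_proof` (item stmt-QuantumFields-8895, closed: Dobrushin–Shlosman
  block recursion on mesh-`b` cells, coupling-free chain rule, far-factor DLR transfer to the torus).
* `cellAnalyticityNSC_of_completeAnalyticityAtLargeScales` — C⁺ is implied by item stmt-QuantumFields-16178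
  (`CertificationLength.CompleteAnalyticityAtLargeScales`: all compact simple `G`, `(n, ε)` chosen before `β`, every
  frame bound `B`; take `B = 1`; the item fixes `borel G`, an arbitrary `[BorelSpace G]` structure is rewritten to it
  by `BorelSpace.measurable_eq`), whence the credited conditional form
  `nonSimplyConnectedLatticeGap_of_completeAnalyticityAtLargeScales : CompleteAnalyticityAtLargeScales → crux`.

`¬ SimplyConnectedSpace G` is not used by the transfer (the same bookkeeping proves the rank-0 target
`UniformLatticeGap` from the un-restricted finite-size condition); it only restricts the open hypothesis C⁺ to the
groups this crux is about. No 't Hooft flux sector enters: the finite-size condition is a statement about finite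
cell unions of `ℤ⁴` with Dirichlet exterior data, over which the engine's bound is uniform, so the torus sectors are
part of the exterior data when the far-factor DLR equation is applied on a non-wrapping box.

References: R. L. Dobrushin, S. B. Shlosman, *Constructive criterion for the uniqueness of Gibbs field* (Birkhäuser
1985), §2; *Completely analytical interactions: constructive description*, J. Stat. Phys. 46 (1987); F. Martinelli,
*Lectures on Glauber dynamics for discrete spin models*, LNM 1717 (1999), §2.3; F. Martinelli, E. Olivieri, *Approach to
equilibrium of Glauber dynamics in the one phase region I*, CMP 161 (1994) (regular volumes).
-/

set_option autoImplicit false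

noncomputable section

open MeasureTheory
open Literature.MathematicalPhysics.QuantumFieldTheory hiding Site ZdEdge
open Literature.MathematicalPhysics.QuantumLattice

namespace Summit.QuantumFields.YangMills.Theorems.NonSimplyConnectedLatticeGap

/-- **Finite-size condition at large `β` ⇒ crux, given the criterion** (pure bookkeeping). If the TV finite-size
criterion with universal threshold holds (`OneCertifiedCube.FiniteSizeCriterion`, item 8895) and for every compact
simple `G` with `¬ SimplyConnectedSpace G` and every faithful unitary `r` there is `β₂` such that at every `β ≥ β₂`
the Wilson specification satisfies the Dobrushin–Shlosman TV finite-size condition at some admissible `(n, ε)` and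
some cell size `b ≥ 1`, then `NonSimplyConnectedLatticeGap`: time clustering at rate `κ(n,ε)/b` on all tori of side
`≥ (8n+7) b`, `n ≤ S`, with the criterion's constant `C(A, B)`. -/
theorem nonSimplyConnectedLatticeGap_of_cellAnalyticityNSC_of_criterion
    (hcrit : Summit.QuantumFields.YangMills.Theses.OneCertifiedCube.FiniteSizeCriterion)
    (hA : ∀ (G : Type) [Group G] [TopologicalSpace G] [IsTopologicalGroup G] [CompactSpace G]
      [MeasurableSpace G] [BorelSpace G], IsCompactSimpleLieGroup G → ¬ SimplyConnectedSpace G →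
      ∀ r : LatticeRep G, ∃ β₂ : ℝ, ∀ β : ℝ, β₂ ≤ β → ∃ (n : ℕ) (ε : ℝ) (b : ℕ), 1 ≤ n ∧ 0 ≤ ε ∧
        ε * ((((4 * n + 3) ^ 4 - (4 * n + 1) ^ 4 : ℕ)) : ℝ) < 1 ∧ 1 ≤ b ∧
        (∀ w : Fin 4 → ℤ → ℤ, (∀ i j, w i j + ((b : ℕ) : ℤ) ≤ w i (j + 1) ∧ w i (j + 1) ≤ w i j + 2 * ((b : ℕ) : ℤ)) → ∀ Y : Finset (Fin 4 → ℤ), Y ⊆ (Fintype.piFinset fun _ : Fin 4 => Finset.Icc (-(2 * ((n : ℕ) : ℤ))) (2 * ((n : ℕ) : ℤ))) → (0 : Fin 4 → ℤ) ∈ Y → ∀ η η' : LGConfig 4 G, (∀ e ∈ (Fintype.piFinset fun _ : Fin 4 => Finset.Icc (-(2 * ((n : ℕ) : ℤ))) (2 * ((n : ℕ) : ℤ))).biUnion (fun y : Fin 4 → ℤ => (Fintype.piFinset fun i : Fin 4 => Finset.Ico (w i (y i)) (w i (y i + 1))) ×ˢ (Finset.univ : Finset (Fin 4))), η e = η' e)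 → ∀ f : LGConfig 4 G → ℝ, IsCylinder f ((fun y : Fin 4 → ℤ => (Fintype.piFinset fun i : Fin 4 => Finset.Ico (w i (y i)) (w i (y i + 1))) ×ˢ (Finset.univ : Finset (Fin 4))) 0) → Measurable f → (∀ U, 0 ≤ f U ∧ f U ≤ 1) → |(∫ U, f U ∂(ymSpecification r.ρ β (Y.biUnion (fun y : Fin 4 → ℤ => (Fintype.piFinset fun i : Fin 4 => Finset.Ico (w i (y i)) (w i (y i + 1))) ×ˢ (Finset.univ : Finset (Fin 4)))) η)) - ∫ U, f U ∂(ymSpecification r.ρ β (Y.biUnion (fun y : Fin 4 → ℤ => (Fintype.piFinset fun i : Fin 4 => Finset.Ico (w i (y i)) (w i (y i + 1))) ×ˢ (Finset.univ : Finset (Fin 4)))) η')| ≤ ε)) :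
    Summit.QuantumFields.YangMills.Theses.ConvexGribovBody.NonSimplyConnectedLatticeGap := by
  intro G _ _ _ _ _ _ hG hnsc r
  obtain ⟨β₂, hβ₂⟩ := hA G hG hnsc r
  refine ⟨β₂, fun β hβ => ?_⟩
  obtain ⟨n, ε, b, hn, hε, hεM, hb1, hTV⟩ := hβ₂ β hβ
  obtain ⟨κ, hκ, hAll⟩ := hcrit n ε hn hε hεM
  have hb0 : (0 : ℝ) < (b : ℝ) := by exact_mod_cast hb1
  refine ⟨κ / b, div_pos hκ hb0, (8 * n + 7) * b, fun A B => ?_⟩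
  obtain ⟨C, hC⟩ := hAll G r.N r.ρ r.continuous r.injective A B
  refine ⟨C, fun S t hS ht => ?_⟩
  have h2S : (8 * n + 7) * b ≤ 2 * S + 1 := by omega
  have h := hC β b hb1 hTV S h2S t ht
  rw [div_mul_eq_mul_div]
  exact h

/-- **Registered form** (stub `stub_cruxOfCellAnalyticityNSC` of the skeleton `Cruxes/NonSimplyConnectedLatticeGap/Lines/Sketch.lean`
of item stmt-QuantumFields-16405; signature `let`-free and fully qualified): the Dobrushin–Shlosman TV finite-size
condition at some admissible `(n, ε)` and some cell size at every `β ≥ β₂(G, r)`, for the compact simple `G` with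
`π₁(G) ≠ 0`, implies the crux `NonSimplyConnectedLatticeGap` — the criterion `OneCertifiedCube.FiniteSizeCriterion`
(item 8895, closed) being discharged by the tree's `FiniteSizeCriterion_proof`. -/
theorem stub_cruxOfCellAnalyticityNSC : (∀ (G : Type) [Group G] [TopologicalSpace G] [IsTopologicalGroup G] [CompactSpace G] [MeasurableSpace G] [BorelSpace G], Literature.MathematicalPhysics.QuantumFieldTheory.IsCompactSimpleLieGroup G → ¬ SimplyConnectedSpace G → ∀ r : Literature.MathematicalPhysics.QuantumFieldTheory.LatticeRep G, ∃ β₂ : ℝ, ∀ β : ℝ, β₂ ≤ β → ∃ (n : ℕ) (ε : ℝ) (b : ℕ), 1 ≤ n ∧ 0 ≤ ε ∧ ε * ((((4 * n + 3) ^ 4 - (4 * n + 1) ^ 4 : ℕ)) : ℝ) < 1 ∧ 1 ≤ b ∧ (∀ w : Fin 4 → ℤ → ℤ, (∀ i j, w i j + ((b : ℕ) : ℤ) ≤ w i (j + 1) ∧ w i (j + 1) ≤ w i j + 2 * ((b : ℕ) : ℤ)) → ∀ Y : Finset (Fin 4 → ℤ), Y ⊆ (Fintype.piFinset fun _ : Fin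 4 => Finset.Icc (-(2 * ((n : ℕ) : ℤ))) (2 * ((n : ℕ) : ℤ))) → (0 : Fin 4 → ℤ) ∈ Y → ∀ η η' : Literature.MathematicalPhysics.QuantumLattice.LGConfig 4 G, (∀ e ∈ (Fintype.piFinset fun _ : Fin 4 => Finset.Icc (-(2 * ((n : ℕ) : ℤ))) (2 * ((n : ℕ) : ℤ))).biUnion (fun y : Fin 4 → ℤ => (Fintype.piFinset fun i : Fin 4 => Finset.Ico (w i (y i)) (w i (y i + 1))) ×ˢ (Finset.univ : Finset (Fin 4))), η e = η' e) → ∀ f : Literature.MathematicalPhysics.QuantumLattice.LGConfig 4 G → ℝ, Literature.MathematicalPhysics.QuantumLattice.IsCylinder f ((fun y : Fin 4 → ℤ => (Fintype.piFinset fun i : Fin 4 => Finset.Ico (w i (y i)) (w i (y i + 1))) ×ˢ (Finset.univ : Finset (Fin 4))) 0) → Measurable f → (∀ U, 0 ≤ f U ∧ f U ≤ 1) → |(∫ U, f U ∂(Literature.MathematicalPhysics.QuantumLattice.ymSpecification r.ρ β (Y.biUnion (fun y : Fin 4 → ℤ => (Fintype.piFinset fun i : Fin 4 => Finset.Ico (w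 i (y i)) (w i (y i + 1))) ×ˢ (Finset.univ : Finset (Fin 4)))) η)) - ∫ U, f U ∂(Literature.MathematicalPhysics.QuantumLattice.ymSpecification r.ρ β (Y.biUnion (fun y : Fin 4 → ℤ => (Fintype.piFinset fun i : Fin 4 => Finset.Ico (w i (y i)) (w i (y i + 1))) ×ˢ (Finset.univ : Finset (Fin 4)))) η')| ≤ ε)) → Summit.QuantumFields.YangMills.Theses.ConvexGribovBody.NonSimplyConnectedLatticeGap :=
  nonSimplyConnectedLatticeGap_of_cellAnalyticityNSC_of_criterion FiniteSizeCriterion_proof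

/-- **C⁺ ⇒ crux** (the transfer of the line under its descriptive name). -/
theorem nonSimplyConnectedLatticeGap_of_cellAnalyticityNSC
    (hA : ∀ (G : Type) [Group G] [TopologicalSpace G] [IsTopologicalGroup G] [CompactSpace G]
      [MeasurableSpace G] [BorelSpace G], IsCompactSimpleLieGroup G → ¬ SimplyConnectedSpace G →
      ∀ r : LatticeRep G, ∃ β₂ : ℝ, ∀ β : ℝ, β₂ ≤ β → ∃ (n : ℕ) (ε : ℝ) (b : ℕ), 1 ≤ n ∧ 0 ≤ ε ∧
        ε * ((((4 * n + 3) ^ 4 - (4 * n + 1) ^ 4 : ℕ)) : ℝ) < 1 ∧ 1 ≤ b ∧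
        (∀ w : Fin 4 → ℤ → ℤ, (∀ i j, w i j + ((b : ℕ) : ℤ) ≤ w i (j + 1) ∧ w i (j + 1) ≤ w i j + 2 * ((b : ℕ) : ℤ)) → ∀ Y : Finset (Fin 4 → ℤ), Y ⊆ (Fintype.piFinset fun _ : Fin 4 => Finset.Icc (-(2 * ((n : ℕ) : ℤ))) (2 * ((n : ℕ) : ℤ))) → (0 : Fin 4 → ℤ) ∈ Y → ∀ η η' : LGConfig 4 G, (∀ e ∈ (Fintype.piFinset fun _ : Fin 4 => Finset.Icc (-(2 * ((n : ℕ) : ℤ))) (2 * ((n : ℕ) : ℤ))).biUnion (fun y : Fin 4 → ℤ => (Fintype.piFinset fun i : Fin 4 => Finset.Ico (w i (y i)) (w i (y i + 1))) ×ˢ (Finset.univ : Finset (Fin 4))), η e = η' e) → ∀ f : LGConfig 4 G → ℝ, IsCylinder f ((fun y : Fin 4 → ℤ => (Fintype.piFinset fun i : Fin 4 => Finset.Ico (w i (y i)) (w i (y i + 1))) ×ˢ (Finset.univ : Finset (Fin 4))) 0) → Measurable f → (∀ U, 0 ≤ f U ∧ f U ≤ 1) → |(∫ U, f U ∂(ymSpecification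 r.ρ β (Y.biUnion (fun y : Fin 4 → ℤ => (Fintype.piFinset fun i : Fin 4 => Finset.Ico (w i (y i)) (w i (y i + 1))) ×ˢ (Finset.univ : Finset (Fin 4)))) η)) - ∫ U, f U ∂(ymSpecification r.ρ β (Y.biUnion (fun y : Fin 4 → ℤ => (Fintype.piFinset fun i : Fin 4 => Finset.Ico (w i (y i)) (w i (y i + 1))) ×ˢ (Finset.univ : Finset (Fin 4)))) η')| ≤ ε)) :
    Summit.QuantumFields.YangMills.Theses.ConvexGribovBody.NonSimplyConnectedLatticeGap :=
  stub_cruxOfCellAnalyticityNSC hA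

/-- **C⁺ is implied by item stmt-QuantumFields-16178** (`CertificationLength.CompleteAnalyticityAtLargeScales`):
forget `¬ SimplyConnectedSpace G`, take frame bound `B = 1`, rewrite the given Borel structure to `borel G`. -/
theorem cellAnalyticityNSC_of_completeAnalyticityAtLargeScales
    (h : Summit.QuantumFields.YangMills.Theses.CertificationLength.CompleteAnalyticityAtLargeScales) :
    ∀ (G : Type) [Group G] [TopologicalSpace G] [IsTopologicalGroup G] [CompactSpace G]
      [MeasurableSpace G] [BorelSpace G], IsCompactSimpleLieGroup G → ¬ SimplyConnectedSpace G →
      ∀ r : LatticeRep G, ∃ β₂ : ℝ, ∀ β : ℝ, β₂ ≤ β → ∃ (n : ℕ) (ε : ℝ) (b : ℕ), 1 ≤ n ∧ 0 ≤ ε ∧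
        ε * ((((4 * n + 3) ^ 4 - (4 * n + 1) ^ 4 : ℕ)) : ℝ) < 1 ∧ 1 ≤ b ∧
        (∀ w : Fin 4 → ℤ → ℤ, (∀ i j, w i j + ((b : ℕ) : ℤ) ≤ w i (j + 1) ∧ w i (j + 1) ≤ w i j + 2 * ((b : ℕ) : ℤ)) → ∀ Y : Finset (Fin 4 → ℤ), Y ⊆ (Fintype.piFinset fun _ : Fin 4 => Finset.Icc (-(2 * ((n : ℕ) : ℤ))) (2 * ((n : ℕ) : ℤ))) → (0 : Fin 4 → ℤ) ∈ Y → ∀ η η' : LGConfig 4 G, (∀ e ∈ (Fintype.piFinset fun _ : Fin 4 => Finset.Icc (-(2 * ((n : ℕ) : ℤ))) (2 * ((n : ℕ) : ℤ))).biUnion (fun y : Fin 4 → ℤ => (Fintype.piFinset fun i : Fin 4 => Finset.Ico (w i (y i)) (w i (y i + 1))) ×ˢ (Finset.univ : Finset (Fin 4))), η e = η' e) → ∀ f : LGConfig 4 G → ℝ, IsCylinder f ((fun y : Fin 4 → ℤ => (Fintype.piFinset fun i : Fin 4 => Finset.Ico (w i (y i)) (w i (y i + 1))) ×ˢ (Finset.univ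 : Finset (Fin 4))) 0) → Measurable f → (∀ U, 0 ≤ f U ∧ f U ≤ 1) → |(∫ U, f U ∂(ymSpecification r.ρ β (Y.biUnion (fun y : Fin 4 → ℤ => (Fintype.piFinset fun i : Fin 4 => Finset.Ico (w i (y i)) (w i (y i + 1))) ×ˢ (Finset.univ : Finset (Fin 4)))) η)) - ∫ U, f U ∂(ymSpecification r.ρ β (Y.biUnion (fun y : Fin 4 → ℤ => (Fintype.piFinset fun i : Fin 4 => Finset.Ico (w i (y i)) (w i (y i + 1))) ×ˢ (Finset.univ : Finset (Fin 4)))) η')| ≤ ε) := by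
  intro G _ _ _ _ iM iB hG _ r
  have hM : iM = borel G := BorelSpace.measurable_eq
  subst hM
  obtain ⟨n, ε, hn, hε, hεM, hB⟩ := h G hG r
  obtain ⟨β₂, hβ₂⟩ := hB 1
  refine ⟨β₂, fun β hβ => ?_⟩
  obtain ⟨b, -, hb1, hTV⟩ := hβ₂ β hβ
  exact ⟨n, ε, b, hn, hε, hεM, hb1, hTV⟩

/-- **Complete analyticity at large scales ⇒ crux** (attachment of the EXISTING item stmt-QuantumFields-16178; the
credited conditional result of the line): `CertificationLength.CompleteAnalyticityAtLargeScales` implies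
`ConvexGribovBody.NonSimplyConnectedLatticeGap`. -/
theorem nonSimplyConnectedLatticeGap_of_completeAnalyticityAtLargeScales
    (h : Summit.QuantumFields.YangMills.Theses.CertificationLength.CompleteAnalyticityAtLargeScales) :
    Summit.QuantumFields.YangMills.Theses.ConvexGribovBody.NonSimplyConnectedLatticeGap :=
  stub_cruxOfCellAnalyticityNSC (cellAnalyticityNSC_of_completeAnalyticityAtLargeScales h)

end Summit.QuantumFields.YangMills.Theorems.NonSimplyConnectedLatticeGap

end
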